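import Summits.CriticalPhenomena.SAWScalingLimit.Theses.SAWDevelopingMap
import Summits.CriticalPhenomena.SAWScalingLimit.Theorems.ObservableToSLE.Negative.CompactContainer
import Summits.CriticalPhenomena.SAWScalingLimit.Theorems.ObservableToSLE.Negative.EndpointNecessity
import Literature.Probability.RandomPlanarGeometry.HullRestrictionTests
import Literature.Probability.RandomPlanarGeometry.SimpleCurves
import Literature.Probability.Percolation.CLE6Proofs

/-!
# Crux `SAWDevelopingMap.ObservableToSLE` (stmt-CriticalPhenomena-10472), line
`floor-ratio-restriction-bootstrap`, stub `stub_chordalCarrier`: what subsequential limits of the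
critical hexagonal SAW inherit from the lattice — honesty, the closed-set transfer, endpoints,
confinement

Landing target:
`Summits/CriticalPhenomena/SAWScalingLimit/Theorems/SAWDevelopingMapObservableToSLEChordalCarrierLimits.lean`
(`--supports stmt-CriticalPhenomena-10472`).

Setting: a Dobrushin domain `(D; a, b)`, lattice endpoints `a δ, b δ`, the critical hexagonal SAW law
`hexSAWLaw D.carrier δ (a δ) (b δ)` (`HexSAW.lean`) pushed to `CurveClass ℂ` by `γ ↦ γ.curve`, and a
probability measure `μ` which is a subsequential limit law of these push-forwards
(`IsSubseqLimitLaw`, portmanteau form along a sequence of meshes `s n → 0⁺`).  PROVED here: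

* honesty along the sequence (`eventually_isProbabilityMeasure_of_tendsto_integral`): the total
  mass of `hexSAWLaw` is `0` or `1`, and weak convergence to a probability measure forces it to be
  `1` for all large `n`;
* **the closed-set transfer** (`le_measureReal_of_isClosed`, `ae_mem_of_isClosed`): for a closed
  `F ⊆ CurveClass ℂ`, an eventual lower bound `q ≤ P_δ(curve ∈ F)` (at the honest meshes) passes to
  `q ≤ μ(F)` — the closed half of the portmanteau theorem, through Mathlib's thickened indicators;
* (E) **endpoints** (`ae_source_eq`, `ae_target_eq`): `μ`-a.e. class starts at `a` and ends at `b`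
  (from `δ a_δ → a`, `δ b_δ → b`: the closed events `dist(source, a) ≤ 1/(k+1)` are sure events on
  the lattice for small `δ`);
* (C) **confinement** (`ae_range_subset_closure`): `μ`-a.e. trace lies in `cl D` (lattice polylines of
  nontrivial walks of `Ω_δ` lie in `cl D`, `range_curve_subset_closure`; closed event);
* the registered-shape sub-goal `stub_chordalCarrier_endpoints` ((E) and (C) together).

The sequel `SAWDevelopingMapObservableToSLEChordalCarrierReduction` reduces the two remaining
clauses of `chordalCarrier D` — simplicity (OPEN: a uniform injectivity modulus of the critical SAW)
and boundary avoidance off `a, b` (collar hull subdomains, from the stub's hypothesis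
`FloorRestrictionLimit`) — with the closed-set transfer of this file.
-/

noncomputable section

open scoped Topology NNReal ENNReal BoundedContinuousFunction
open Filter Set MeasureTheory Metric
open Literature.Probability.LatticeModels (HexVertex hexGraph hexCenter)
open Literature.Probability.RandomPlanarGeometry
open Literature.Probability.RandomPlanarGeometry.SAW

namespace Summit.CriticalPhenomena.SAWScalingLimit.Theorems.ObservableToSLE.FloorRatio

open Summit.CriticalPhenomena.SAWScalingLimit.Theorems.ObservableToSLE.Negative
  (source_hexCurve target_hexCurve measureReal_preimage_le_integral
    mem_embMeshVertices_of_mem_support)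

/-! ### Honesty of the critical hexagonal SAW law -/

section Honesty

variable (Ω : Set ℂ) (δ : ℝ) (u v : HexVertex)

/-- The total mass of `hexSAWLaw` is `0` (no SAW from `u` to `v`, or infinite total weight) or
`1`. [folklore] -/
theorem hexSAWLaw_univ_eq_zero_or_one :
    hexSAWLaw Ω δ u v univ = 0 ∨ hexSAWLaw Ω δ u v univ = 1 := by
  rw [show hexSAWLaw Ω δ u v = (hexSAWWeight Ω δ u v univ)⁻¹ • hexSAWWeight Ω δ u v from rfl,
    Measure.smul_apply, smul_eq_mul]
  rcases eq_or_ne (hexSAWWeight Ω δ u v univ) 0 with h0 | h0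
  · left; rw [h0, mul_zero]
  rcases eq_or_ne (hexSAWWeight Ω δ u v univ) ∞ with ht | ht
  · left; rw [ht, ENNReal.inv_top, zero_mul]
  · right; exact ENNReal.inv_mul_cancel h0 ht

/-- `hexSAWLaw` is a finite measure. [folklore] -/
theorem isFiniteMeasure_hexSAWLaw : IsFiniteMeasure (hexSAWLaw Ω δ u v) := by
  refine ⟨?_⟩
  rcases hexSAWLaw_univ_eq_zero_or_one Ω δ u v with h | h <;> rw [h] <;> simp

variable {Ω δ u v}

/-- `hexSAWLaw` is a probability measure as soon as it is nonzero. [folklore] -/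
theorem isProbabilityMeasure_hexSAWLaw_of_ne_zero (h : hexSAWLaw Ω δ u v univ ≠ 0) :
    IsProbabilityMeasure (hexSAWLaw Ω δ u v) :=
  ⟨(hexSAWLaw_univ_eq_zero_or_one Ω δ u v).resolve_left h⟩

/-- **Honesty along a weakly convergent sequence.** If the push-forward SAW laws along `s n`
converge on bounded continuous test functions to a probability measure, then for all large `n` the
law at mesh `s n` is a probability measure (test function `1`; masses lie in `{0, 1}`). [folklore] -/
theorem eventually_isProbabilityMeasure_of_tendsto_integral {D : DobrushinDomain}
    {a b : ℝ → HexVertex} {μ : Measure (CurveClass ℂ)} [IsProbabilityMeasure μ] {s : ℕ → ℝ}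
    (hlim : ∀ f : CurveClass ℂ →ᵇ ℝ, Tendsto
      (fun n ↦ ∫ γ, f γ.curve ∂hexSAWLaw D.carrier (s n) (a (s n)) (b (s n))) atTop
      (𝓝 (∫ x, f x ∂μ))) :
    ∀ᶠ n in atTop, IsProbabilityMeasure (hexSAWLaw D.carrier (s n) (a (s n)) (b (s n))) := by
  have h1 := hlim 1
  have hl : (fun n ↦ ∫ γ, (1 : CurveClass ℂ →ᵇ ℝ) γ.curve
      ∂hexSAWLaw D.carrier (s n) (a (s n)) (b (s n))) =
      fun n ↦ (hexSAWLaw D.carrier (s n) (a (s n)) (b (s n)) univ).toReal := by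
    funext n; simp [Measure.real]
  have hr : ∫ x, (1 : CurveClass ℂ →ᵇ ℝ) x ∂μ = 1 := by simp
  rw [hl, hr] at h1
  have hev : ∀ᶠ n in atTop,
      (hexSAWLaw D.carrier (s n) (a (s n)) (b (s n)) univ).toReal ∈ Ioi (1 / 2 : ℝ) :=
    h1 (Ioi_mem_nhds (by norm_num))
  filter_upwards [hev] with n hn
  refine isProbabilityMeasure_hexSAWLaw_of_ne_zero fun h0 ↦ ?_
  rw [h0, ENNReal.toReal_zero, mem_Ioi] at hn
  norm_num at hn

end Honesty

/-! ### The closed-set transfer (closed half of the portmanteau theorem) -/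

section Transfer

variable {D : DobrushinDomain} {a b : ℝ → HexVertex} {μ : Measure (CurveClass ℂ)}

/-- A probability measure charging a measurable set with mass `≥ 1` charges its complement with
mass `0`. [folklore] -/
theorem ae_mem_of_one_le_measureReal [IsProbabilityMeasure μ] {U : Set (CurveClass ℂ)}
    (hU : MeasurableSet U) (h : 1 ≤ μ.real U) : ∀ᵐ c ∂μ, c ∈ U := by
  have h1 : μ.real U = 1 := le_antisymm measureReal_le_one h
  have h2 : μ U = 1 := (ENNReal.toReal_eq_one_iff _).1 h1
  rw [ae_iff]
  change μ Uᶜ = 0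
  rwa [prob_compl_eq_zero_iff hU]

/-- **Closed-set transfer.** Let `μ` be a probability subsequential limit law of the critical
hexagonal SAW curves and `F` a closed set of curve classes. If for all small meshes at which the
SAW law is a probability measure, `q ≤ P_δ(curve ∈ F)`, then `q ≤ μ(F)`: test the weak convergence
on the thickened indicators `g_k ≥ 𝟙_F` of `F` and let `k → ∞` (`∫ g_k dμ → μ(F)`).
[cite: BillingsleyCPM1999, Thm. 2.1 (portmanteau, closed sets)] -/
theorem le_measureReal_of_isClosed [IsProbabilityMeasure μ]
    (hμ : IsSubseqLimitLaw (fun δ (γ : HexDomainSAW D.carrier δ (a δ) (b δ)) => γ.curve)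
      (fun δ => hexSAWLaw D.carrier δ (a δ) (b δ)) μ)
    {F : Set (CurveClass ℂ)} (hF : IsClosed F) {q : ℝ}
    (h : ∀ᶠ δ in 𝓝[>] (0 : ℝ), IsProbabilityMeasure (hexSAWLaw D.carrier δ (a δ) (b δ)) →
      q ≤ (hexSAWLaw D.carrier δ (a δ) (b δ)).real {γ | γ.curve ∈ F}) :
    q ≤ μ.real F := by
  obtain ⟨s, hs, hlim⟩ := hμ
  have hP := eventually_isProbabilityMeasure_of_tendsto_integral hlim
  have hq := hs.eventually h
  have key : ∀ k : ℕ,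
      q ≤ ∫ x, (thickenedIndicator (Nat.one_div_pos_of_nat (n := k)) F x : ℝ) ∂μ := by
    intro k
    set g : CurveClass ℂ →ᵇ ℝ := BoundedContinuousFunction.comp _ NNReal.isometry_coe.lipschitz
      (thickenedIndicator (Nat.one_div_pos_of_nat (n := k)) F) with hg
    have hgap : ∀ x, g x = (thickenedIndicator (Nat.one_div_pos_of_nat (n := k)) F x : ℝ) :=
      fun x ↦ rfl
    refine ge_of_tendsto (hlim g) ?_
    filter_upwards [hP, hq] with n hPn hqn
    haveI := hPn
    calc q ≤ (hexSAWLaw D.carrier (s n) (a (s n)) (b (s n))).real {γ | γ.curve ∈ F} := hqn hPn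
      _ ≤ ∫ γ, g γ.curve ∂hexSAWLaw D.carrier (s n) (a (s n)) (b (s n)) := by
          refine measureReal_preimage_le_integral (EmbDomainSAW.measurable_of_top _)
            hF.measurableSet (fun x ↦ ?_) (fun x hx ↦ ?_)
          · rw [hgap]; exact NNReal.coe_nonneg _
          · rw [hgap, thickenedIndicator_one _ _ hx, NNReal.coe_one]
  have hlimk := tendsto_integral_thickenedIndicator_of_isClosed μ hF
    (fun k ↦ Nat.one_div_pos_of_nat (n := k)) tendsto_one_div_add_atTop_nhds_zero_nat
  exact ge_of_tendsto hlimk (Eventually.of_forall key)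

/-- **Sure closed events pass to the limit.** If `F` is closed and, for all small honest meshes,
every SAW curve class lies in `F`, then `μ`-a.e. class lies in `F`.
[cite: BillingsleyCPM1999, Thm. 2.1 (portmanteau, closed sets)] -/
theorem ae_mem_of_isClosed [IsProbabilityMeasure μ]
    (hμ : IsSubseqLimitLaw (fun δ (γ : HexDomainSAW D.carrier δ (a δ) (b δ)) => γ.curve)
      (fun δ => hexSAWLaw D.carrier δ (a δ) (b δ)) μ)
    {F : Set (CurveClass ℂ)} (hF : IsClosed F)
    (h : ∀ᶠ δ in 𝓝[>] (0 : ℝ), IsProbabilityMeasure (hexSAWLaw D.carrier δ (a δ) (b δ)) →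
      ∀ γ : HexDomainSAW D.carrier δ (a δ) (b δ), γ.curve ∈ F) :
    ∀ᵐ c ∂μ, c ∈ F := by
  refine ae_mem_of_one_le_measureReal hF.measurableSet
    (le_measureReal_of_isClosed hμ hF (h.mono fun δ hδ hP ↦ ?_))
  haveI := hP
  rw [show {γ : HexDomainSAW D.carrier δ (a δ) (b δ) | γ.curve ∈ F} = univ from
    eq_univ_of_forall (hδ hP), probReal_univ]

end Transfer

/-! ### (E) Endpoints of the limit classes -/

section Endpoints

variable {D : DobrushinDomain} {a b : ℝ → HexVertex} {μ : Measure (CurveClass ℂ)}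

/-- **The limit classes start at `a`.** If `δ · a_δ → a` then `μ`-a.e. `c.source = a`.
[cite: BillingsleyCPM1999, Thm. 2.1 (portmanteau, closed sets)] -/
theorem ae_source_eq [IsProbabilityMeasure μ]
    (hμ : IsSubseqLimitLaw (fun δ (γ : HexDomainSAW D.carrier δ (a δ) (b δ)) => γ.curve)
      (fun δ => hexSAWLaw D.carrier δ (a δ) (b δ)) μ)
    (ha : Tendsto (fun δ : ℝ => (δ : ℂ) * hexCenter (a δ)) (𝓝[>] (0 : ℝ)) (𝓝 (D.pt 0))) :
    ∀ᵐ c ∂μ, c.source = D.pt 0 := by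
  have hk : ∀ k : ℕ, ∀ᵐ c ∂μ,
      c ∈ {c : CurveClass ℂ | dist c.source (D.pt 0) ≤ 1 / ((k : ℝ) + 1)} := by
    intro k
    refine ae_mem_of_isClosed hμ
      (isClosed_le (CurveClass.continuous_source.dist continuous_const) continuous_const) ?_
    have hev := ha.eventually_mem (closedBall_mem_nhds (D.pt 0) (Nat.one_div_pos_of_nat (n := k)))
    exact hev.mono fun δ hδ _ γ ↦ by
      rw [mem_setOf_eq, source_hexCurve]; exact mem_closedBall.1 hδ
  filter_upwards [ae_all_iff.2 hk] with c hc
  have h0 : dist c.source (D.pt 0) ≤ 0 :=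
    ge_of_tendsto' tendsto_one_div_add_atTop_nhds_zero_nat fun k ↦ hc k
  exact dist_le_zero.1 h0

/-- **The limit classes end at `b`.** If `δ · b_δ → b` then `μ`-a.e. `c.target = b`.
[cite: BillingsleyCPM1999, Thm. 2.1 (portmanteau, closed sets)] -/
theorem ae_target_eq [IsProbabilityMeasure μ]
    (hμ : IsSubseqLimitLaw (fun δ (γ : HexDomainSAW D.carrier δ (a δ) (b δ)) => γ.curve)
      (fun δ => hexSAWLaw D.carrier δ (a δ) (b δ)) μ)
    (hb : Tendsto (fun δ : ℝ => (δ : ℂ) * hexCenter (b δ)) (𝓝[>] (0 : ℝ)) (𝓝 (D.pt 1))) :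
    ∀ᵐ c ∂μ, c.target = D.pt 1 := by
  have hk : ∀ k : ℕ, ∀ᵐ c ∂μ,
      c ∈ {c : CurveClass ℂ | dist c.target (D.pt 1) ≤ 1 / ((k : ℝ) + 1)} := by
    intro k
    refine ae_mem_of_isClosed hμ
      (isClosed_le (CurveClass.continuous_target.dist continuous_const) continuous_const) ?_
    have hev := hb.eventually_mem (closedBall_mem_nhds (D.pt 1) (Nat.one_div_pos_of_nat (n := k)))
    exact hev.mono fun δ hδ _ γ ↦ by
      rw [mem_setOf_eq, target_hexCurve]; exact mem_closedBall.1 hδ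
  filter_upwards [ae_all_iff.2 hk] with c hc
  have h0 : dist c.target (D.pt 1) ≤ 0 :=
    ge_of_tendsto' tendsto_one_div_add_atTop_nhds_zero_nat fun k ↦ hc k
  exact dist_le_zero.1 h0

/-- Under an endpoint approximation `μ`-a.e. limit class runs from `a` to `b`; in particular its
endpoints differ. [folklore] -/
theorem ae_source_eq_and_target_eq [IsProbabilityMeasure μ]
    (hab : IsEmbEndpointApprox hexGraph hexCenter D a b)
    (hμ : IsSubseqLimitLaw (fun δ (γ : HexDomainSAW D.carrier δ (a δ) (b δ)) => γ.curve)
      (fun δ => hexSAWLaw D.carrier δ (a δ) (b δ)) μ) :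
    ∀ᵐ c ∂μ, c.source = D.pt 0 ∧ c.target = D.pt 1 ∧ c.source ≠ c.target := by
  filter_upwards [ae_source_eq hμ hab.tendsto_fst, ae_target_eq hμ hab.tendsto_snd] with c h0 h1
  refine ⟨h0, h1, ?_⟩
  rw [h0, h1]
  exact fun h ↦ absurd (D.pt_injective h) (by decide)

end Endpoints

/-! ### (C) Confinement of the limit classes to `cl D` -/

section Confinement

variable {D : DobrushinDomain} {a b : ℝ → HexVertex} {μ : Measure (CurveClass ℂ)}

/-- A walk all of whose vertices are `Ω'`-mesh vertices and all of whose steps are `Ω'`-mesh edges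
traces a polyline inside `cl Ω'`. [folklore] -/
theorem curve_mem_rangeSubset_of_meshWalk {Ω Ω' : Set ℂ} {δ : ℝ} {u v : HexVertex}
    (γ : HexDomainSAW Ω δ u v) (hv : ∀ w ∈ γ.walk.support, w ∈ embMeshVertices hexCenter Ω' δ)
    (he : ∀ e ∈ γ.walk.darts, (embMeshGraph hexGraph hexCenter Ω' δ).Adj e.fst e.snd) :
    γ.curve ∈ CurveClass.rangeSubset (closure Ω') := by
  change Set.range (γ.walk.toCurve fun w ↦ (δ : ℂ) * hexCenter w) ⊆ closure Ω'
  exact SimpleGraph.Walk.range_toCurve_subset γ.walk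
    (subset_closure (hv _ (SimpleGraph.Walk.start_mem_support _)))
    fun d hd ↦ ((embMeshGraph_adj_iff hexGraph hexCenter).1 (he d hd)).2

/-- **Lattice confinement**: the polyline of a NONTRIVIAL self-avoiding walk of `Ω_δ` lies in
`cl Ω` (its vertices are mesh vertices of `Ω`, its edges are mesh edges, whose segments lie in
`cl Ω` by definition of the mesh graph). [folklore] -/
theorem range_curve_subset_closure {Ω : Set ℂ} {δ : ℝ} {u v : HexVertex} (huv : u ≠ v)
    (γ : HexDomainSAW Ω δ u v) : γ.curve.range ⊆ closure Ω :=
  curve_mem_rangeSubset_of_meshWalk γ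
    (fun _ hw ↦ mem_embMeshVertices_of_mem_support huv γ.walk hw)
    (fun d _ ↦ ((embDomainGraph_adj_iff hexGraph hexCenter).1 d.adj).1)

/-- The lattice endpoints of an endpoint approximation are eventually distinct. [folklore] -/
theorem eventually_ne_of_tendsto
    (ha : Tendsto (fun δ : ℝ => (δ : ℂ) * hexCenter (a δ)) (𝓝[>] (0 : ℝ)) (𝓝 (D.pt 0)))
    (hb : Tendsto (fun δ : ℝ => (δ : ℂ) * hexCenter (b δ)) (𝓝[>] (0 : ℝ)) (𝓝 (D.pt 1))) :
    ∀ᶠ δ in 𝓝[>] (0 : ℝ), a δ ≠ b δ := by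
  have hd : 0 < dist (D.pt 0) (D.pt 1) :=
    dist_pos.2 fun h ↦ absurd (D.pt_injective h) (by decide)
  filter_upwards [ha.eventually_mem (ball_mem_nhds _ (half_pos hd)),
    hb.eventually_mem (ball_mem_nhds _ (half_pos hd))] with δ h0 h1 heq
  rw [heq] at h0
  rw [mem_ball] at h0 h1
  have := dist_triangle_left (D.pt 0) (D.pt 1) ((δ : ℂ) * hexCenter (b δ))
  linarith

/-- **The limit classes lie in `cl D`.** [cite: BillingsleyCPM1999, Thm. 2.1 (portmanteau, closed sets)] -/
theorem ae_range_subset_closure [IsProbabilityMeasure μ]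
    (hμ : IsSubseqLimitLaw (fun δ (γ : HexDomainSAW D.carrier δ (a δ) (b δ)) => γ.curve)
      (fun δ => hexSAWLaw D.carrier δ (a δ) (b δ)) μ)
    (ha : Tendsto (fun δ : ℝ => (δ : ℂ) * hexCenter (a δ)) (𝓝[>] (0 : ℝ)) (𝓝 (D.pt 0)))
    (hb : Tendsto (fun δ : ℝ => (δ : ℂ) * hexCenter (b δ)) (𝓝[>] (0 : ℝ)) (𝓝 (D.pt 1))) :
    ∀ᵐ c ∂μ, c.range ⊆ closure D.carrier :=
  ae_mem_of_isClosed (F := CurveClass.rangeSubset (closure D.carrier)) hμ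
    (CurveClass.isClosed_rangeSubset isClosed_closure)
    ((eventually_ne_of_tendsto ha hb).mono fun _ hδ _ γ ↦ range_curve_subset_closure hδ γ)

end Confinement

/-! ### Registered form: endpoints and confinement (sub-goal of `stub_chordalCarrier`) -/

/-- **Registered sub-goal `stub_chordalCarrier_endpoints`** (crux item stmt-CriticalPhenomena-10472,
line `floor-ratio-restriction-bootstrap`, stub `stub_chordalCarrier`, parts (E) and (C)): for every
Dobrushin domain and endpoint approximation, every probability subsequential limit law of the
critical hexagonal SAW curves is carried by classes from `a` to `b` with trace in `cl D` — three of
the five clauses of `chordalCarrier D` (the remaining two, simplicity and boundary avoidance off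
`a, b`, are reduced in the sibling file to the uniform injectivity modulus and to collar families).
[cite: BillingsleyCPM1999, Thm. 2.1 (portmanteau, closed sets)] -/
theorem stub_chordalCarrier_endpoints :
    ∀ (D : DobrushinDomain) (a b : ℝ → HexVertex), IsEmbEndpointApprox hexGraph hexCenter D a b →
    ∀ μ : Measure (CurveClass ℂ), IsProbabilityMeasure μ →
      IsSubseqLimitLaw (fun δ (γ : HexDomainSAW D.carrier δ (a δ) (b δ)) => γ.curve)
        (fun δ => hexSAWLaw D.carrier δ (a δ) (b δ)) μ →
      ∀ᵐ c ∂μ, c.source = D.pt 0 ∧ c.target = D.pt 1 ∧ c.range ⊆ closure D.carrier := by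
  intro D a b hab μ hμP hμ
  filter_upwards [ae_source_eq_and_target_eq hab hμ,
    ae_range_subset_closure hμ hab.tendsto_fst hab.tendsto_snd] with c h1 h2
  exact ⟨h1.1, h1.2.1, h2⟩

end Summit.CriticalPhenomena.SAWScalingLimit.Theorems.ObservableToSLE.FloorRatio

end
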